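import Literature.Analysis.FluidPDE.EnstrophySplitting
import HarnessLib

/-!
# The `L^θ` energy identities on `ℝ³` (Lemarié-Rieusset 2016, §11.5, proof of Prop. 11.7, (11.45)–(11.46), (11.52)–(11.53))

Analysis/FluidPDE proof file (theorems only: no definition, no named fact, no `sorry`). Second
brick (after `LThetaEnergyBalance.lean`) of the `ℝ³` energy method "estimate `d/dt ‖u(t)‖_θ^θ`"
of P. G. Lemarié-Rieusset, *The Navier–Stokes Problem in the 21st Century* (2016), §11.5, proof of
Prop. 11.7 (pressure criteria), PDF pp. 362–366: the three spatial identities that turn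
`θ ∫ |u|^{θ-2} u · ∂ₜu` into dissipation + pressure,

* (11.46)/(11.53) `∫ (u·∇u) · |u|^{θ-2} u dx = 0` (`div u = 0`):
  `integral_inner_convect_norm_rpow_smul_eq_zero` (`θ ≥ 2`);
* (11.45)/(11.52) `∫ Δu · |u|^{θ-2} u dx = -∫ |u|^{θ-2} |∇ ⊗ u|² dx - (θ-2) Σⱼ ∫ |∂ⱼu · u|² |u|^{θ-4} dx`:
  `integral_inner_laplacian_norm_rpow_smul` (`θ ≥ 4`);
* the pressure pairing integrated by parts, `J = θ∫ |u|^{θ-2} u · ∇ϖ = -θ ∫ ϖ u · ∇|u|^{θ-2}`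
  (the step before (11.48)–(11.49) and (11.55)–(11.56)):
  `integral_inner_gradient_norm_rpow_smul` (`θ ≥ 4`): `∫ ⟪∇π, |v|^{θ-2} v⟫ = -(θ-2) ∫ π |v|^{θ-4} ⟪v, (v·∇)v⟫`;
* their combination along a Navier–Stokes slice `W + (v·∇)v = νΔv - ∇q`
  (`integral_norm_rpow_inner_eq_of_momentum`): `θ∫‖v‖^{θ-2}⟪v, W⟫ = -νθ ∫(‖v‖^{θ-2}|∇v|²_F +
  (θ-2)‖v‖^{θ-4}Σᵢ⟪v,∂ᵢv⟫²) + θ(θ-2)∫ q ‖v‖^{θ-4}⟪v,(v·∇)v⟫` — the density of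
  `IsSmoothSpaceTimeOn.lTheta_balance` evaluated, i.e. the display after (11.46)/(11.53) with `f = 0`,

for `C¹`/`C²`, bounded fields on `ℝ³` with the `L²` finiteness of the classical slices of Tao's
`L²`-Sobolev class (`v, Dv, D²v, π, Dπ ∈ L²`), by the tree's whole-space integrations by parts
(`integral_sum_inner_fderiv_fderiv_eq_neg_integral_inner_laplacian`,
`integral_inner_gradient_eq_zero_of_isDivFree_R3`, and the coordinatewise Mathlib
`integral_mul_fderiv_eq_neg_fderiv_mul_of_integrable`). The exponent `θ` is real; the weight
`‖v‖^{θ-2}` is handled through `‖v‖^p = (‖v‖²)^{p/2}` (`C¹` for `p ≥ 2`).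

Vendored by the literature seat of the cell `pub-nsfunc` ("search for candidate a priori estimates;
no regularity claim") as infrastructure towards the discharge of the named fact
`pressureGradientCriterion` (`GradientRegularityCriteria.lean`, Lemarié-Rieusset Prop. 11.7 second
item; Berselli–Galdi 2002 Thm. 3.3), whose printed proof is this energy method with `θ = 4`
(`1 < q < 3`) and `θ = 3q - 2` (`q ≥ 3`).

## References

* [LemarieRieusset2016] P. G. Lemarié-Rieusset, *The Navier–Stokes Problem in the 21st Century*,
  CRC Press 2016, §11.5, proof of Prop. 11.7, (11.44)–(11.49), (11.51)–(11.56)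
  (held text, PDF pp. 362–366).
* [BerselliGaldi2002] L. C. Berselli, G. P. Galdi, Proc. AMS 130 (2002) 3585–3595, Thm. 3.3,
  (3.2) p. 3593 (the same computation with `θ = n`).
-/

noncomputable section

open MeasureTheory Set Function Filter Topology InnerProductSpace
open scoped ENNReal NNReal ContDiff RealInnerProductSpace Laplacian

namespace Literature.Analysis.FluidPDE

section Pointwise

/-- `‖a‖^p = (‖a‖²)^{p/2}`. [folklore] -/
private theorem norm_rpow_eq_sq_rpow (a : EuclideanSpace ℝ (Fin 3)) (p : ℝ) :
    ‖a‖ ^ p = (‖a‖ ^ 2) ^ (p / 2) := by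
  rw [← Real.rpow_natCast ‖a‖ 2, ← Real.rpow_mul (norm_nonneg _)]
  congr 1
  push_cast
  ring

/-- Differentiability of `y ↦ ‖v y‖^p`, `p ≥ 2`, at a point of differentiability of `v`, with
`D(‖v‖^p)(x) h = p ‖v x‖^{p-2} ⟪v x, Dv(x) h⟫` (chain rule through `‖v‖^p = (‖v‖²)^{p/2}`).
[folklore] -/
private theorem fderiv_norm_rpow_apply
    {v : EuclideanSpace ℝ (Fin 3) → EuclideanSpace ℝ (Fin 3)}
    {x : EuclideanSpace ℝ (Fin 3)} (hd : DifferentiableAt ℝ v x) {p : ℝ} (hp : 2 ≤ p) :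
    DifferentiableAt ℝ (fun y => ‖v y‖ ^ p) x ∧
      ∀ h, fderiv ℝ (fun y => ‖v y‖ ^ p) x h = p * ‖v x‖ ^ (p - 2) * ⟪v x, fderiv ℝ v x h⟫ := by
  have h1 := hd.hasFDerivAt.norm_sq
  have h2 := h1.rpow_const (p := p / 2) (Or.inr (by linarith))
  have h3 : HasFDerivAt (fun y => ‖v y‖ ^ p) _ x :=
    h2.congr_of_eventuallyEq (Eventually.of_forall fun y => norm_rpow_eq_sq_rpow (v y) p)
  refine ⟨h3.differentiableAt, fun h => ?_⟩
  rw [h3.fderiv]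
  simp [innerSL_apply_apply]
  rw [norm_rpow_eq_sq_rpow (v x) (p - 2)]
  have : (p - 2) / 2 = p / 2 - 1 := by ring
  rw [this]
  ring

/-- `y ↦ ‖v y‖^p` is `C¹` for `v ∈ C¹` and `p ≥ 2`. [folklore] -/
private theorem contDiff_norm_rpow {v : EuclideanSpace ℝ (Fin 3) → EuclideanSpace ℝ (Fin 3)}
    (hv : ContDiff ℝ 1 v) {p : ℝ} (hp : 2 ≤ p) : ContDiff ℝ 1 (fun y => ‖v y‖ ^ p) := by
  have h : ContDiff ℝ 1 (fun y => (‖v y‖ ^ 2) ^ (p / 2)) :=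
    (hv.norm_sq ℝ).rpow_const_of_le (by norm_cast; linarith)
  have hfun : (fun y => ‖v y‖ ^ p) = fun y => (‖v y‖ ^ 2) ^ (p / 2) :=
    funext fun y => norm_rpow_eq_sq_rpow (v y) p
  rw [hfun]
  exact h

/-- The derivative of the test field `W = ‖v‖^{θ-2} v` (`θ ≥ 4`):
`DW(x) h = ‖v x‖^{θ-2} Dv(x) h + (θ-2) ‖v x‖^{θ-4} ⟪v x, Dv(x) h⟫ v x`. [folklore] -/
private theorem fderiv_norm_rpow_smul_apply
    {v : EuclideanSpace ℝ (Fin 3) → EuclideanSpace ℝ (Fin 3)} (hv : ContDiff ℝ 1 v)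
    {θ : ℝ} (hθ : 4 ≤ θ) (x h : EuclideanSpace ℝ (Fin 3)) :
    DifferentiableAt ℝ (fun y => ‖v y‖ ^ (θ - 2) • v y) x ∧
    fderiv ℝ (fun y => ‖v y‖ ^ (θ - 2) • v y) x h = ‖v x‖ ^ (θ - 2) • fderiv ℝ v x h +
      ((θ - 2) * ‖v x‖ ^ (θ - 4) * ⟪v x, fderiv ℝ v x h⟫) • v x := by
  have hdV : ∀ y, DifferentiableAt ℝ v y := fun y => (hv.differentiable (by simp)) y
  obtain ⟨hdiff, happ⟩ := fderiv_norm_rpow_apply (hdV x) (p := θ - 2) (by linarith)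
  refine ⟨hdiff.smul (hdV x), ?_⟩
  rw [fderiv_fun_smul hdiff (hdV x)]
  simp only [add_apply, ContinuousLinearMap.smulRight_apply, happ h]
  have : θ - 2 - 2 = θ - 4 := by ring
  rw [this]
  rfl

/-- `‖‖v‖^{θ-2} v‖ ≤ B^{θ-2} ‖v‖` when `‖v‖ ≤ B`. [folklore] -/
private theorem norm_norm_rpow_smul_le
    {v : EuclideanSpace ℝ (Fin 3) → EuclideanSpace ℝ (Fin 3)} {θ : ℝ} (hθ : 2 ≤ θ)
    {B : ℝ} (hB : ∀ x, ‖v x‖ ≤ B) (y : EuclideanSpace ℝ (Fin 3)) :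
    ‖‖v y‖ ^ (θ - 2) • v y‖ ≤ ‖(B ^ (θ - 2)) • v y‖ := by
  have hB0 : 0 ≤ B := (norm_nonneg _).trans (hB y)
  rw [norm_smul, norm_smul, Real.norm_of_nonneg (Real.rpow_nonneg (norm_nonneg _) _),
    Real.norm_of_nonneg (Real.rpow_nonneg hB0 _)]
  exact mul_le_mul_of_nonneg_right (Real.rpow_le_rpow (norm_nonneg _) (hB y) (by linarith))
    (norm_nonneg _)

/-- `‖D(‖v‖^{θ-2} v)(y) h‖ ≤ (θ-1) B^{θ-2} ‖Dv(y) h‖` when `‖v‖ ≤ B`, `θ ≥ 4`. [folklore] -/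
private theorem norm_fderiv_norm_rpow_smul_apply_le
    {v : EuclideanSpace ℝ (Fin 3) → EuclideanSpace ℝ (Fin 3)} (hv : ContDiff ℝ 1 v)
    {θ : ℝ} (hθ : 4 ≤ θ) {B : ℝ} (hB : ∀ x, ‖v x‖ ≤ B) (y h : EuclideanSpace ℝ (Fin 3)) :
    ‖fderiv ℝ (fun y => ‖v y‖ ^ (θ - 2) • v y) y h‖ ≤
      ‖((θ - 1) * B ^ (θ - 2)) • fderiv ℝ v y h‖ := by
  have hB0 : 0 ≤ B := (norm_nonneg _).trans (hB y)
  have hpowB : ‖v y‖ ^ (θ - 2) ≤ B ^ (θ - 2) :=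
    Real.rpow_le_rpow (norm_nonneg _) (hB y) (by linarith)
  have hsplit : ‖v y‖ ^ (θ - 4) * ‖v y‖ * ‖v y‖ = ‖v y‖ ^ (θ - 2) := by
    rw [mul_assoc, ← sq, ← Real.rpow_natCast (‖v y‖) 2,
      ← Real.rpow_add' (norm_nonneg _) (by push_cast; linarith)]
    congr 1
    push_cast
    ring
  rw [(fderiv_norm_rpow_smul_apply hv hθ y h).2, norm_smul, Real.norm_of_nonneg (by
    have : 0 ≤ B ^ (θ - 2) := Real.rpow_nonneg hB0 _
    nlinarith)]
  have h1 : ‖‖v y‖ ^ (θ - 2) • fderiv ℝ v y h‖ = ‖v y‖ ^ (θ - 2) * ‖fderiv ℝ v y h‖ := by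
    rw [norm_smul, Real.norm_of_nonneg (Real.rpow_nonneg (norm_nonneg _) _)]
  have h2 : ‖((θ - 2) * ‖v y‖ ^ (θ - 4) * ⟪v y, fderiv ℝ v y h⟫) • v y‖ ≤
      (θ - 2) * ‖v y‖ ^ (θ - 2) * ‖fderiv ℝ v y h‖ := by
    rw [norm_smul, norm_mul, norm_mul, Real.norm_of_nonneg (by linarith : (0:ℝ) ≤ θ - 2),
      Real.norm_of_nonneg (Real.rpow_nonneg (norm_nonneg _) _)]
    calc (θ - 2) * ‖v y‖ ^ (θ - 4) * ‖⟪v y, fderiv ℝ v y h⟫‖ * ‖v y‖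
        ≤ (θ - 2) * ‖v y‖ ^ (θ - 4) * (‖v y‖ * ‖fderiv ℝ v y h‖) * ‖v y‖ := by
          have h0 : 0 ≤ (θ - 2) * ‖v y‖ ^ (θ - 4) :=
            mul_nonneg (by linarith) (Real.rpow_nonneg (norm_nonneg _) _)
          exact mul_le_mul_of_nonneg_right
            (mul_le_mul_of_nonneg_left (norm_inner_le_norm _ _) h0) (norm_nonneg _)
      _ = (θ - 2) * (‖v y‖ ^ (θ - 4) * ‖v y‖ * ‖v y‖) * ‖fderiv ℝ v y h‖ := by ring
      _ = (θ - 2) * ‖v y‖ ^ (θ - 2) * ‖fderiv ℝ v y h‖ := by rw [hsplit]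
  calc ‖‖v y‖ ^ (θ - 2) • fderiv ℝ v y h + ((θ - 2) * ‖v y‖ ^ (θ - 4) * ⟪v y, fderiv ℝ v y h⟫) • v y‖
      ≤ ‖v y‖ ^ (θ - 2) * ‖fderiv ℝ v y h‖ + (θ - 2) * ‖v y‖ ^ (θ - 2) * ‖fderiv ℝ v y h‖ := by
          refine (norm_add_le _ _).trans ?_
          rw [h1]
          exact add_le_add le_rfl h2
    _ = (θ - 1) * (‖v y‖ ^ (θ - 2) * ‖fderiv ℝ v y h‖) := by ring
    _ ≤ (θ - 1) * (B ^ (θ - 2) * ‖fderiv ℝ v y h‖) :=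
        mul_le_mul_of_nonneg_left (mul_le_mul_of_nonneg_right hpowB (norm_nonneg _)) (by linarith)
    _ = (θ - 1) * B ^ (θ - 2) * ‖fderiv ℝ v y h‖ := by ring

/-- `L²` finiteness is preserved by constant scalings. [folklore] -/
private theorem lTheta_lintegral_enorm_sq_smul_lt_top
    {f : EuclideanSpace ℝ (Fin 3) → EuclideanSpace ℝ (Fin 3)} (c : ℝ)
    (hf : ∫⁻ x, ‖f x‖ₑ ^ 2 < ⊤) : ∫⁻ x, ‖c • f x‖ₑ ^ 2 < ⊤ := by
  have : ∀ x, ‖c • f x‖ₑ ^ 2 = ‖c‖ₑ ^ 2 * ‖f x‖ₑ ^ 2 := fun x => by rw [enorm_smul, mul_pow]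
  simp_rw [this]
  rw [lintegral_const_mul' _ _ (by simp)]
  exact ENNReal.mul_lt_top (by simp) hf

end Pointwise

/-! ### The transport term vanishes: `∫ ⟪(v·∇)v, |v|^{θ-2} v⟫ = 0` -/

section Transport

/-- **The convection term does not see the `L^θ` energy** (Lemarié-Rieusset 2016, proof of
Prop. 11.7, (11.46) for `θ = 4` and (11.53) in general: `∫ (u·∇u) · |u|^{θ-2} u dx = 0` since
`div u = 0`). For a `C¹`, bounded, divergence-free field `v` on `ℝ³` with `v, Dv ∈ L²` and a real
exponent `θ ≥ 2`: `∫ ⟪(v·∇)v, ‖v‖^{θ-2} v⟫ = 0`. Proof: pointwise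
`⟪(v·∇)v, ‖v‖^{θ-2}v⟫ = ⟪∇F, v⟫` with `F = θ⁻¹ ‖v‖^θ`, and `∫ ⟪∇F, v⟫ = 0` for divergence-free
`v` (`integral_inner_gradient_eq_zero_of_isDivFree_R3`).
[cite: LemarieRieusset2016, §11.5 Prop. 11.7 proof, (11.46) and (11.53) (PDF pp. 363, 365)] -/
theorem integral_inner_convect_norm_rpow_smul_eq_zero
    {v : EuclideanSpace ℝ (Fin 3) → EuclideanSpace ℝ (Fin 3)} (hv : ContDiff ℝ 1 v)
    (hdiv : VectorCalculus.IsDivFree v) {θ : ℝ} (hθ : 2 ≤ θ)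
    {B : ℝ} (hB : ∀ x, ‖v x‖ ≤ B)
    (hv0 : ∫⁻ x, ‖v x‖ₑ ^ 2 < ⊤) (hv1 : ∫⁻ x, ‖iteratedFDeriv ℝ 1 v x‖ₑ ^ 2 < ⊤) :
    ∫ x, ⟪FluidPDE.convect v v x, ‖v x‖ ^ (θ - 2) • v x⟫ = 0 := by
  set e := EuclideanSpace.basisFun (Fin 3) ℝ with he
  have he1 : ∀ i, ‖e i‖ = 1 := fun i => by simp [he]
  have hB0 : 0 ≤ B := (norm_nonneg _).trans (hB 0)
  have hθ0 : 0 < θ := by linarith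
  have hdV : ∀ y, DifferentiableAt ℝ v y := fun y => (hv.differentiable (by simp)) y
  -- the potential `F = θ⁻¹ ‖v‖^θ`
  set F : EuclideanSpace ℝ (Fin 3) → ℝ := fun y => θ⁻¹ * ‖v y‖ ^ θ with hFdef
  have hFc : ContDiff ℝ 1 F := contDiff_const.mul (contDiff_norm_rpow hv hθ)
  have hdF : ∀ y h, fderiv ℝ F y h = ‖v y‖ ^ (θ - 2) * ⟪v y, fderiv ℝ v y h⟫ := by
    intro y h
    obtain ⟨hdiff, happ⟩ := fderiv_norm_rpow_apply (hdV y) hθ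
    rw [hFdef]
    rw [fderiv_const_mul hdiff,
      show (θ⁻¹ • fderiv ℝ (fun y => ‖v y‖ ^ θ) y) h = θ⁻¹ * fderiv ℝ (fun y => ‖v y‖ ^ θ) y h
        from rfl, happ h]
    field_simp
  -- the integrand is `⟪∇F, v⟫`
  have hpt : ∀ y, ⟪FluidPDE.convect v v y, ‖v y‖ ^ (θ - 2) • v y⟫ = ⟪gradient F y, v y⟫ := by
    intro y
    rw [gradient, InnerProductSpace.toDual_symm_apply, hdF, FluidPDE.convect, inner_smul_right,
      real_inner_comm]
  simp_rw [hpt]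
  -- continuity and `L²` bookkeeping
  have cv : Continuous v := hv.continuous
  have cDv : Continuous (fderiv ℝ v) := hv.continuous_fderiv (by simp)
  have cdiv : ∀ i, Continuous fun x => fderiv ℝ v x (e i) := fun i => cDv.clm_apply continuous_const
  have cF : Continuous F := hFc.continuous
  have cdF : ∀ i, Continuous fun x => fderiv ℝ F x (e i) := fun i =>
    (hFc.continuous_fderiv (by simp)).clm_apply continuous_const
  have cBv : Continuous fun x => (B ^ (θ - 1)) • v x := cv.const_smul (B ^ (θ - 1))
  have cBθv : Continuous fun x => (θ⁻¹ * B ^ (θ - 1)) • v x := cv.const_smul (θ⁻¹ * B ^ (θ - 1))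
  have l2div : ∀ i, ∫⁻ x, ‖fderiv ℝ v x (e i)‖ₑ ^ 2 < ⊤ := fun i =>
    lintegral_enorm_sq_lt_top_of_norm_le (fun x => norm_fderiv_apply_basisFun_le v x i) hv1
  have l2smul : ∀ c : ℝ, ∫⁻ x, ‖c • v x‖ₑ ^ 2 < ⊤ := by
    intro c
    have : ∀ x, ‖c • v x‖ₑ ^ 2 = ‖c‖ₑ ^ 2 * ‖v x‖ₑ ^ 2 := fun x => by rw [enorm_smul, mul_pow]
    simp_rw [this]
    rw [lintegral_const_mul' _ _ (by simp)]
    exact ENNReal.mul_lt_top (by simp) hv0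
  -- pointwise bounds: `‖v‖^{θ-1} ≤ B^{θ-2} ‖v‖`, `‖v‖^θ ≤ B^{θ-1} ‖v‖`
  have hpow1 : ∀ y, ‖v y‖ ^ (θ - 2) * ‖v y‖ ≤ B ^ (θ - 2) * ‖v y‖ := fun y =>
    mul_le_mul_of_nonneg_right (Real.rpow_le_rpow (norm_nonneg _) (hB y) (by linarith))
      (norm_nonneg _)
  have hpow2 : ∀ y, ‖v y‖ ^ θ ≤ B ^ (θ - 1) * ‖v y‖ := by
    intro y
    have h1 : ‖v y‖ ^ θ = ‖v y‖ ^ (θ - 1) * ‖v y‖ := by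
      conv_lhs => rw [show θ = (θ - 1) + 1 by ring]
      rw [Real.rpow_add' (norm_nonneg _) (by linarith), Real.rpow_one]
    rw [h1]
    exact mul_le_mul_of_nonneg_right (Real.rpow_le_rpow (norm_nonneg _) (hB y) (by linarith))
      (norm_nonneg _)
  have hin : ∀ i (y : EuclideanSpace ℝ (Fin 3)), ‖⟪e i, y⟫‖ ≤ ‖y‖ := fun i y =>
    (norm_inner_le_norm (𝕜 := ℝ) (e i) y).trans (by rw [he1, one_mul])
  have hdFle : ∀ i y, ‖fderiv ℝ F y (e i)‖ ≤ B ^ (θ - 2) * ‖v y‖ * ‖fderiv ℝ v y (e i)‖ := by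
    intro i y
    rw [hdF, norm_mul, Real.norm_of_nonneg (Real.rpow_nonneg (norm_nonneg _) _)]
    calc ‖v y‖ ^ (θ - 2) * ‖⟪v y, fderiv ℝ v y (e i)⟫‖
        ≤ ‖v y‖ ^ (θ - 2) * (‖v y‖ * ‖fderiv ℝ v y (e i)‖) :=
          mul_le_mul_of_nonneg_left (norm_inner_le_norm _ _) (Real.rpow_nonneg (norm_nonneg _) _)
      _ = (‖v y‖ ^ (θ - 2) * ‖v y‖) * ‖fderiv ℝ v y (e i)‖ := by ring
      _ ≤ B ^ (θ - 2) * ‖v y‖ * ‖fderiv ℝ v y (e i)‖ :=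
          mul_le_mul_of_nonneg_right (hpow1 y) (norm_nonneg _)
  refine integral_inner_gradient_eq_zero_of_isDivFree_R3 hFc hv hdiv (fun i => ?_) (fun i => ?_)
    (fun i => ?_)
  · -- `⟪eᵢ, v⟫ ∂ᵢF`: bounded by `(B^{θ-1} ‖v‖) ‖∂ᵢv‖`... via `‖v‖ B^{θ-2} ‖v‖ ‖∂ᵢv‖ ≤ ‖B^{θ-1} • v‖ ‖∂ᵢv‖`
    refine integrable_of_norm_le_mul_of_lintegral_sq
      ((continuous_const.inner cv).mul (cdF i)).aestronglyMeasurable cBv (cdiv i) (l2smul _)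
      (l2div i) fun y => ?_
    rw [norm_mul]
    calc ‖⟪e i, v y⟫‖ * ‖fderiv ℝ F y (e i)‖
        ≤ ‖v y‖ * (B ^ (θ - 2) * ‖v y‖ * ‖fderiv ℝ v y (e i)‖) :=
          mul_le_mul (hin i _) (hdFle i y) (norm_nonneg _) (norm_nonneg _)
      _ = (B ^ (θ - 2) * ‖v y‖) * ‖v y‖ * ‖fderiv ℝ v y (e i)‖ := by ring
      _ ≤ (B ^ (θ - 2) * B) * ‖v y‖ * ‖fderiv ℝ v y (e i)‖ := by
          have h0 : 0 ≤ B ^ (θ - 2) := Real.rpow_nonneg hB0 _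
          have h1 : B ^ (θ - 2) * ‖v y‖ ≤ B ^ (θ - 2) * B := mul_le_mul_of_nonneg_left (hB y) h0
          have h2 : 0 ≤ ‖v y‖ * ‖fderiv ℝ v y (e i)‖ := mul_nonneg (norm_nonneg _) (norm_nonneg _)
          calc (B ^ (θ - 2) * ‖v y‖) * ‖v y‖ * ‖fderiv ℝ v y (e i)‖
              = (B ^ (θ - 2) * ‖v y‖) * (‖v y‖ * ‖fderiv ℝ v y (e i)‖) := by ring
            _ ≤ (B ^ (θ - 2) * B) * (‖v y‖ * ‖fderiv ℝ v y (e i)‖) :=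
                mul_le_mul_of_nonneg_right h1 h2
            _ = (B ^ (θ - 2) * B) * ‖v y‖ * ‖fderiv ℝ v y (e i)‖ := by ring
      _ = ‖(B ^ (θ - 1)) • v y‖ * ‖fderiv ℝ v y (e i)‖ := by
          rw [norm_smul, Real.norm_of_nonneg (Real.rpow_nonneg hB0 _),
            show B ^ (θ - 1) = B ^ (θ - 2) * B by
              rw [show θ - 1 = (θ - 2) + 1 by ring, Real.rpow_add' hB0 (by linarith), Real.rpow_one]]
  · -- `⟪eᵢ, ∂ᵢv⟫ F`
    refine integrable_of_norm_le_mul_of_lintegral_sq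
      ((continuous_const.inner (cdiv i)).mul cF).aestronglyMeasurable (cdiv i) cBθv (l2div i)
      (l2smul _) fun y => ?_
    rw [norm_mul]
    refine mul_le_mul (hin i _) ?_ (norm_nonneg _) (norm_nonneg _)
    rw [hFdef]
    simp only
    rw [norm_mul, norm_smul, Real.norm_of_nonneg (inv_nonneg.2 hθ0.le),
      Real.norm_of_nonneg (Real.rpow_nonneg (norm_nonneg _) _), Real.norm_of_nonneg (by positivity),
      mul_assoc]
    exact mul_le_mul_of_nonneg_left (hpow2 y) (inv_nonneg.2 hθ0.le)
  · -- `⟪eᵢ, v⟫ F`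
    refine integrable_of_norm_le_mul_of_lintegral_sq
      ((continuous_const.inner cv).mul cF).aestronglyMeasurable cv cBθv hv0 (l2smul _) fun y => ?_
    rw [norm_mul]
    refine mul_le_mul (hin i _) ?_ (norm_nonneg _) (norm_nonneg _)
    rw [hFdef]
    simp only
    rw [norm_mul, norm_smul, Real.norm_of_nonneg (inv_nonneg.2 hθ0.le),
      Real.norm_of_nonneg (Real.rpow_nonneg (norm_nonneg _) _), Real.norm_of_nonneg (by positivity),
      mul_assoc]
    exact mul_le_mul_of_nonneg_left (hpow2 y) (inv_nonneg.2 hθ0.le)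

end Transport

/-! ### The dissipation identity: `∫ ⟪Δv, |v|^{θ-2} v⟫` -/

section Dissipation

/-- **The viscous term against `|v|^{θ-2} v`** (Lemarié-Rieusset 2016, proof of Prop. 11.7,
(11.45) for `θ = 4` and (11.52) in general:
`∫ Δu · |u|^{θ-2}u dx = -∫ |u|^{θ-2} |∇ ⊗ u|² dx - (θ-2) Σⱼ ∫ |∂ⱼu · u|² |u|^{θ-4} dx`). For a
`C²`, bounded field `v` on `ℝ³` with `v, Dv, D²v ∈ L²` and a real exponent `θ ≥ 4`:
`∫ ⟪Δv, ‖v‖^{θ-2} v⟫ = -∫ (‖v‖^{θ-2} |∇v|²_F + (θ-2) ‖v‖^{θ-4} Σᵢ ⟪v, ∂ᵢv⟫²)`. Proof: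
`∫ Σᵢ ⟪∂ᵢv, ∂ᵢW⟫ = -∫ ⟪Δv, W⟫` (`integral_sum_inner_fderiv_fderiv_eq_neg_integral_inner_laplacian`)
with `W = ‖v‖^{θ-2} v`, `∂ᵢW = ‖v‖^{θ-2} ∂ᵢv + (θ-2) ‖v‖^{θ-4} ⟪v, ∂ᵢv⟫ v`.
[cite: LemarieRieusset2016, §11.5 Prop. 11.7 proof, (11.45) and (11.52) (PDF pp. 363, 365)] -/
theorem integral_inner_laplacian_norm_rpow_smul
    {v : EuclideanSpace ℝ (Fin 3) → EuclideanSpace ℝ (Fin 3)} (hv : ContDiff ℝ 2 v)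
    {θ : ℝ} (hθ : 4 ≤ θ) {B : ℝ} (hB : ∀ x, ‖v x‖ ≤ B)
    (hv0 : ∫⁻ x, ‖v x‖ₑ ^ 2 < ⊤) (hv1 : ∫⁻ x, ‖iteratedFDeriv ℝ 1 v x‖ₑ ^ 2 < ⊤)
    (hv2 : ∫⁻ x, ‖iteratedFDeriv ℝ 2 v x‖ₑ ^ 2 < ⊤) :
    ∫ x, ⟪(Δ v) x, ‖v x‖ ^ (θ - 2) • v x⟫ =
      -∫ x, (‖v x‖ ^ (θ - 2) * FluidPDE.frobeniusNormSq (fderiv ℝ v x) +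
        (θ - 2) * ‖v x‖ ^ (θ - 4) *
          ∑ i, ⟪v x, fderiv ℝ v x (EuclideanSpace.basisFun (Fin 3) ℝ i)⟫ ^ 2) := by
  set e := EuclideanSpace.basisFun (Fin 3) ℝ with he
  have he1 : ∀ i, ‖e i‖ = 1 := fun i => by simp [he]
  have hB0 : 0 ≤ B := (norm_nonneg _).trans (hB 0)
  have hθ2 : 2 ≤ θ - 2 := by linarith
  have hv1' : ContDiff ℝ 1 v := hv.of_le (by norm_num)
  have hdV : ∀ y, DifferentiableAt ℝ v y := fun y => (hv.differentiable (by simp)) y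
  -- the test field `W = ‖v‖^{θ-2} v` and its partial derivatives
  set W : EuclideanSpace ℝ (Fin 3) → EuclideanSpace ℝ (Fin 3) := fun y => ‖v y‖ ^ (θ - 2) • v y
    with hWdef
  have hW : ContDiff ℝ 1 W := (contDiff_norm_rpow hv1' hθ2).smul hv1'
  have hdW : ∀ x i, fderiv ℝ W x (e i) = ‖v x‖ ^ (θ - 2) • fderiv ℝ v x (e i) +
      ((θ - 2) * ‖v x‖ ^ (θ - 4) * ⟪v x, fderiv ℝ v x (e i)⟫) • v x := fun x i =>
    (fderiv_norm_rpow_smul_apply hv1' hθ x (e i)).2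
  -- pointwise density
  have hpt : ∀ x, ∑ i, ⟪fderiv ℝ v x (e i), fderiv ℝ W x (e i)⟫ =
      ‖v x‖ ^ (θ - 2) * FluidPDE.frobeniusNormSq (fderiv ℝ v x) +
        (θ - 2) * ‖v x‖ ^ (θ - 4) * ∑ i, ⟪v x, fderiv ℝ v x (e i)⟫ ^ 2 := by
    intro x
    rw [FluidPDE.frobeniusNormSq_eq_sum e, Finset.mul_sum, Finset.mul_sum, ← Finset.sum_add_distrib]
    refine Finset.sum_congr rfl fun i _ => ?_
    rw [hdW x i, inner_add_right, inner_smul_right, inner_smul_right, real_inner_self_eq_norm_sq,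
      real_inner_comm (v x) (fderiv ℝ v x (e i))]
    ring
  -- continuity and `L²` bookkeeping
  have cv : Continuous v := hv.continuous
  have cDv : Continuous (fderiv ℝ v) := hv.continuous_fderiv (by simp)
  have cdiv : ∀ i, Continuous fun x => fderiv ℝ v x (e i) := fun i => cDv.clm_apply continuous_const
  have cdvs : ∀ i, Continuous fun x => fderiv ℝ (fun y => fderiv ℝ v y (e i)) x (e i) := fun i =>
    ((((hv.fderiv_right (m := 1) (by norm_num)).clm_apply contDiff_const).continuous_fderiv
      (by norm_num)).clm_apply continuous_const)
  have cW : Continuous W := hW.continuous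
  have cdW : ∀ i, Continuous fun x => fderiv ℝ W x (e i) := fun i =>
    (hW.continuous_fderiv (by simp)).clm_apply continuous_const
  have l2div : ∀ i, ∫⁻ x, ‖fderiv ℝ v x (e i)‖ₑ ^ 2 < ⊤ := fun i =>
    lintegral_enorm_sq_lt_top_of_norm_le (fun x => norm_fderiv_apply_basisFun_le v x i) hv1
  have l2ddv : ∀ i, ∫⁻ x, ‖fderiv ℝ (fun y => fderiv ℝ v y (e i)) x (e i)‖ₑ ^ 2 < ⊤ := fun i =>
    lintegral_enorm_sq_lt_top_of_norm_le (fun x => norm_fderiv_fderiv_apply_basisFun_le hv x i) hv2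
  have hWle : ∀ y, ‖W y‖ ≤ ‖(B ^ (θ - 2)) • v y‖ := fun y =>
    norm_norm_rpow_smul_le (by linarith) hB y
  have hdWle : ∀ i y, ‖fderiv ℝ W y (e i)‖ ≤ ‖((θ - 1) * B ^ (θ - 2)) • fderiv ℝ v y (e i)‖ :=
    fun i y => norm_fderiv_norm_rpow_smul_apply_le hv1' hθ hB y (e i)
  -- integrability of the three pairings
  have cBv : Continuous fun x => (B ^ (θ - 2)) • v x := cv.const_smul (B ^ (θ - 2))
  have cBdv : ∀ i, Continuous fun x => ((θ - 1) * B ^ (θ - 2)) • fderiv ℝ v x (e i) := fun i =>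
    (cdiv i).const_smul ((θ - 1) * B ^ (θ - 2))
  have i1 : ∀ i, Integrable (fun x => ⟪fderiv ℝ (fun y => fderiv ℝ v y (e i)) x (e i), W x⟫)
      volume := fun i =>
    integrable_of_norm_le_mul_of_lintegral_sq ((cdvs i).inner cW).aestronglyMeasurable (cdvs i) cBv
      (l2ddv i) (lTheta_lintegral_enorm_sq_smul_lt_top _ hv0) fun x =>
        (norm_inner_le_norm _ _).trans (mul_le_mul_of_nonneg_left (hWle x) (norm_nonneg _))
  have i2 : ∀ i, Integrable (fun x => ⟪fderiv ℝ v x (e i), fderiv ℝ W x (e i)⟫) volume := fun i =>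
    integrable_of_norm_le_mul_of_lintegral_sq ((cdiv i).inner (cdW i)).aestronglyMeasurable
      (cdiv i) (cBdv i) (l2div i) (lTheta_lintegral_enorm_sq_smul_lt_top _ (l2div i)) fun x =>
        (norm_inner_le_norm _ _).trans (mul_le_mul_of_nonneg_left (hdWle i x) (norm_nonneg _))
  have i3 : ∀ i, Integrable (fun x => ⟪fderiv ℝ v x (e i), W x⟫) volume := fun i =>
    integrable_of_norm_le_mul_of_lintegral_sq ((cdiv i).inner cW).aestronglyMeasurable (cdiv i) cBv
      (l2div i) (lTheta_lintegral_enorm_sq_smul_lt_top _ hv0) fun x =>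
        (norm_inner_le_norm _ _).trans (mul_le_mul_of_nonneg_left (hWle x) (norm_nonneg _))
  -- integrate by parts
  have hIBP := integral_sum_inner_fderiv_fderiv_eq_neg_integral_inner_laplacian hv hW i1 i2 i3
  have hWx : ∀ x, W x = ‖v x‖ ^ (θ - 2) • v x := fun x => rfl
  simp_rw [← hWx]
  rw [← neg_eq_iff_eq_neg.2 hIBP]
  congr 1
  exact integral_congr_ae (Eventually.of_forall fun x => (hpt x).symm) |>.symm

end Dissipation

/-! ### The pressure term: `∫ ⟪∇π, |v|^{θ-2} v⟫ = -(θ-2) ∫ π |v|^{θ-4} ⟪v, (v·∇)v⟫` -/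

section Pressure

/-- Integration by parts `∫ ⟪∇q, w⟫ = -∫ q div w` on `ℝ³` for `C¹` fields with the three
coordinate pairings integrable (coordinatewise, Mathlib
`integral_mul_fderiv_eq_neg_fderiv_mul_of_integrable`; the proof of the tree's
`integral_inner_gradient_eq_zero_of_isDivFree_R3` without the divergence constraint). [folklore] -/
private theorem integral_inner_gradient_eq_neg_integral_mul_divergence_of_integrable
    {q : EuclideanSpace ℝ (Fin 3) → ℝ} {w : EuclideanSpace ℝ (Fin 3) → EuclideanSpace ℝ (Fin 3)}
    (hq : ContDiff ℝ 1 q) (hw : ContDiff ℝ 1 w)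
    (h1 : ∀ i, Integrable (fun x => ⟪EuclideanSpace.basisFun (Fin 3) ℝ i, w x⟫ *
      fderiv ℝ q x (EuclideanSpace.basisFun (Fin 3) ℝ i)) volume)
    (h2 : ∀ i, Integrable (fun x => ⟪EuclideanSpace.basisFun (Fin 3) ℝ i,
      fderiv ℝ w x (EuclideanSpace.basisFun (Fin 3) ℝ i)⟫ * q x) volume)
    (h3 : ∀ i, Integrable (fun x => ⟪EuclideanSpace.basisFun (Fin 3) ℝ i, w x⟫ * q x) volume) :
    ∫ x, ⟪gradient q x, w x⟫ = -∫ x, q x * VectorCalculus.divergence w x := by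
  set e := EuclideanSpace.basisFun (Fin 3) ℝ with he
  have hdq : Differentiable ℝ q := hq.differentiable one_ne_zero
  have hdwi : ∀ i, Differentiable ℝ (fun y => ⟪e i, w y⟫) := fun i =>
    ((innerSL ℝ (e i)).differentiable).comp (hw.differentiable one_ne_zero)
  have hderiv : ∀ i x, fderiv ℝ (fun y => ⟪e i, w y⟫) x (e i) = ⟪e i, fderiv ℝ w x (e i)⟫ :=
    fun i x => fderiv_inner_const_left_apply_of_contDiff hw (e i) x (e i)
  have hIBP : ∀ i, ∫ x, ⟪e i, w x⟫ * fderiv ℝ q x (e i) =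
      - ∫ x, ⟪e i, fderiv ℝ w x (e i)⟫ * q x := by
    intro i
    have h2' : Integrable (fun x => fderiv ℝ (fun y => ⟪e i, w y⟫) x (e i) * q x) volume := by
      simp_rw [hderiv]; exact h2 i
    have := integral_mul_fderiv_eq_neg_fderiv_mul_of_integrable (μ := volume)
      (f := fun y => ⟪e i, w y⟫) (g := q) (v := e i) h2' (h1 i) (h3 i)
      (fun x _ => hdwi i x) (fun x _ => hdq x)
    rw [this]
    simp_rw [hderiv]
  have hsum : (fun x => ⟪gradient q x, w x⟫) = fun x => ∑ i, ⟪e i, w x⟫ * fderiv ℝ q x (e i) :=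
    funext fun x => inner_gradient_eq_sum_basisFun q x (w x)
  rw [hsum, integral_finsetSum _ fun i _ => h1 i]
  simp_rw [hIBP]
  rw [Finset.sum_neg_distrib, ← integral_finsetSum _ fun i _ => h2 i]
  congr 1
  refine integral_congr_ae (Eventually.of_forall fun x => ?_)
  simp only
  rw [FluidPDE.divergence_eq_sum_inner_fderiv e w x, Finset.mul_sum]
  exact Finset.sum_congr rfl fun i _ => by ring

/-- **The divergence of the test field** `W = ‖v‖^{θ-2} v` for divergence-free `v`:
`div W = (θ-2) ‖v‖^{θ-4} ⟪v, (v·∇)v⟫` (`= ⟪v, ∇‖v‖^{θ-2}⟫`). [folklore] -/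
private theorem divergence_norm_rpow_smul
    {v : EuclideanSpace ℝ (Fin 3) → EuclideanSpace ℝ (Fin 3)} (hv : ContDiff ℝ 1 v)
    (hdiv : VectorCalculus.IsDivFree v) {θ : ℝ} (hθ : 4 ≤ θ) (x : EuclideanSpace ℝ (Fin 3)) :
    VectorCalculus.divergence (fun y => ‖v y‖ ^ (θ - 2) • v y) x =
      (θ - 2) * ‖v x‖ ^ (θ - 4) * ⟪v x, FluidPDE.convect v v x⟫ := by
  set e := EuclideanSpace.basisFun (Fin 3) ℝ with he
  rw [FluidPDE.divergence_eq_sum_inner_fderiv e]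
  have hdW : ∀ i, fderiv ℝ (fun y => ‖v y‖ ^ (θ - 2) • v y) x (e i) =
      ‖v x‖ ^ (θ - 2) • fderiv ℝ v x (e i) +
        ((θ - 2) * ‖v x‖ ^ (θ - 4) * ⟪v x, fderiv ℝ v x (e i)⟫) • v x := fun i =>
    (fderiv_norm_rpow_smul_apply hv hθ x (e i)).2
  simp_rw [hdW, inner_add_right, inner_smul_right, Finset.sum_add_distrib, ← Finset.mul_sum]
  rw [← FluidPDE.divergence_eq_sum_inner_fderiv e v x, hdiv x, mul_zero, zero_add]
  -- `Σᵢ (c ⟪v, ∂ᵢv⟫) ⟪eᵢ, v⟫ = c ⟪v, Dv(v)⟫`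
  have hrepr : ∑ i, ⟪e i, v x⟫ • e i = v x := e.sum_repr' (v x)
  have hDv : fderiv ℝ v x (v x) = ∑ i, ⟪e i, v x⟫ • fderiv ℝ v x (e i) := by
    calc fderiv ℝ v x (v x) = fderiv ℝ v x (∑ i, ⟪e i, v x⟫ • e i) := by rw [hrepr]
      _ = ∑ i, ⟪e i, v x⟫ • fderiv ℝ v x (e i) := by
          rw [map_sum]
          exact Finset.sum_congr rfl fun i _ => by rw [map_smul]
  have hlin : ∑ i, ⟪v x, fderiv ℝ v x (e i)⟫ * ⟪e i, v x⟫ = ⟪v x, FluidPDE.convect v v x⟫ := by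
    rw [FluidPDE.convect, hDv, inner_sum]
    exact Finset.sum_congr rfl fun i _ => by rw [inner_smul_right, mul_comm]
  rw [← hlin, Finset.mul_sum]
  exact Finset.sum_congr rfl fun i _ => by ring

/-- **The pressure term against `|v|^{θ-2} v`, integrated by parts** (Lemarié-Rieusset 2016,
proof of Prop. 11.7, the term `J = θ ∫ |u|^{θ-2} u · ∇ϖ dx = -θ ∫ ϖ u · ∇|u|^{θ-2} dx`, leading to
(11.48)/(11.49) for `θ = 4` and (11.55)/(11.56) in general). For `π ∈ C¹` and a `C¹`, bounded,
divergence-free field `v` on `ℝ³` with `π, Dπ, v, Dv ∈ L²` and `θ ≥ 4`: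
`∫ ⟪∇π, ‖v‖^{θ-2} v⟫ = -(θ-2) ∫ π ‖v‖^{θ-4} ⟪v, (v·∇)v⟫`.
[cite: LemarieRieusset2016, §11.5 Prop. 11.7 proof, (11.48)–(11.49) and (11.55)–(11.56) (PDF pp. 363, 366)] -/
theorem integral_inner_gradient_norm_rpow_smul
    {π : EuclideanSpace ℝ (Fin 3) → ℝ} {v : EuclideanSpace ℝ (Fin 3) → EuclideanSpace ℝ (Fin 3)}
    (hπ : ContDiff ℝ 1 π) (hv : ContDiff ℝ 1 v) (hdiv : VectorCalculus.IsDivFree v)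
    {θ : ℝ} (hθ : 4 ≤ θ) {B : ℝ} (hB : ∀ x, ‖v x‖ ≤ B)
    (hv0 : ∫⁻ x, ‖v x‖ₑ ^ 2 < ⊤) (hv1 : ∫⁻ x, ‖iteratedFDeriv ℝ 1 v x‖ₑ ^ 2 < ⊤)
    (hπ0 : ∫⁻ x, ‖π x‖ₑ ^ 2 < ⊤) (hπ1 : ∫⁻ x, ‖iteratedFDeriv ℝ 1 π x‖ₑ ^ 2 < ⊤) :
    ∫ x, ⟪gradient π x, ‖v x‖ ^ (θ - 2) • v x⟫ =
      -((θ - 2) * ∫ x, π x * (‖v x‖ ^ (θ - 4) * ⟪v x, FluidPDE.convect v v x⟫)) := by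
  set e := EuclideanSpace.basisFun (Fin 3) ℝ with he
  have he1 : ∀ i, ‖e i‖ = 1 := fun i => by simp [he]
  have hθ2 : 2 ≤ θ - 2 := by linarith
  -- the test field
  set W : EuclideanSpace ℝ (Fin 3) → EuclideanSpace ℝ (Fin 3) := fun y => ‖v y‖ ^ (θ - 2) • v y
    with hWdef
  have hW : ContDiff ℝ 1 W := (contDiff_norm_rpow hv hθ2).smul hv
  -- continuity and `L²` bookkeeping
  have cv : Continuous v := hv.continuous
  have cDv : Continuous (fderiv ℝ v) := hv.continuous_fderiv (by simp)
  have cdiv : ∀ i, Continuous fun x => fderiv ℝ v x (e i) := fun i => cDv.clm_apply continuous_const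
  have cW : Continuous W := hW.continuous
  have cdW : ∀ i, Continuous fun x => fderiv ℝ W x (e i) := fun i =>
    (hW.continuous_fderiv (by simp)).clm_apply continuous_const
  have cπ : Continuous π := hπ.continuous
  have cdπ : ∀ i, Continuous fun x => fderiv ℝ π x (e i) := fun i =>
    (hπ.continuous_fderiv (by simp)).clm_apply continuous_const
  have l2div : ∀ i, ∫⁻ x, ‖fderiv ℝ v x (e i)‖ₑ ^ 2 < ⊤ := fun i =>
    lintegral_enorm_sq_lt_top_of_norm_le (fun x => norm_fderiv_apply_basisFun_le v x i) hv1
  have l2dπ : ∀ i, ∫⁻ x, ‖fderiv ℝ π x (e i)‖ₑ ^ 2 < ⊤ := fun i =>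
    lintegral_enorm_sq_lt_top_of_norm_le (fun x => norm_fderiv_apply_basisFun_le π x i) hπ1
  have hWle : ∀ y, ‖W y‖ ≤ ‖(B ^ (θ - 2)) • v y‖ := fun y =>
    norm_norm_rpow_smul_le (by linarith) hB y
  have hdWle : ∀ i y, ‖fderiv ℝ W y (e i)‖ ≤ ‖((θ - 1) * B ^ (θ - 2)) • fderiv ℝ v y (e i)‖ :=
    fun i y => norm_fderiv_norm_rpow_smul_apply_le hv hθ hB y (e i)
  have cBv : Continuous fun x => (B ^ (θ - 2)) • v x := cv.const_smul (B ^ (θ - 2))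
  have cBdv : ∀ i, Continuous fun x => ((θ - 1) * B ^ (θ - 2)) • fderiv ℝ v x (e i) := fun i =>
    (cdiv i).const_smul ((θ - 1) * B ^ (θ - 2))
  have hin : ∀ i (y : EuclideanSpace ℝ (Fin 3)), ‖⟪e i, y⟫‖ ≤ ‖y‖ := fun i y =>
    (norm_inner_le_norm (𝕜 := ℝ) (e i) y).trans (by rw [he1, one_mul])
  -- the three pairings
  have h1 : ∀ i, Integrable (fun x => ⟪e i, W x⟫ * fderiv ℝ π x (e i)) volume := fun i =>
    integrable_of_norm_le_mul_of_lintegral_sq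
      ((continuous_const.inner cW).mul (cdπ i)).aestronglyMeasurable cBv (cdπ i)
      (lTheta_lintegral_enorm_sq_smul_lt_top _ hv0) (l2dπ i) fun x => by
        rw [norm_mul]
        exact mul_le_mul_of_nonneg_right ((hin i _).trans (hWle x)) (norm_nonneg _)
  have h2 : ∀ i, Integrable (fun x => ⟪e i, fderiv ℝ W x (e i)⟫ * π x) volume := fun i =>
    integrable_of_norm_le_mul_of_lintegral_sq
      ((continuous_const.inner (cdW i)).mul cπ).aestronglyMeasurable (cBdv i) cπ
      (lTheta_lintegral_enorm_sq_smul_lt_top _ (l2div i)) hπ0 fun x => by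
        rw [norm_mul]
        exact mul_le_mul_of_nonneg_right ((hin i _).trans (hdWle i x)) (norm_nonneg _)
  have h3 : ∀ i, Integrable (fun x => ⟪e i, W x⟫ * π x) volume := fun i =>
    integrable_of_norm_le_mul_of_lintegral_sq
      ((continuous_const.inner cW).mul cπ).aestronglyMeasurable cBv cπ
      (lTheta_lintegral_enorm_sq_smul_lt_top _ hv0) hπ0 fun x => by
        rw [norm_mul]
        exact mul_le_mul_of_nonneg_right ((hin i _).trans (hWle x)) (norm_nonneg _)
  have hIBP := integral_inner_gradient_eq_neg_integral_mul_divergence_of_integrable hπ hW h1 h2 h3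
  have hWx : ∀ x, W x = ‖v x‖ ^ (θ - 2) • v x := fun x => rfl
  simp_rw [← hWx]
  rw [hIBP, ← integral_const_mul]
  congr 1
  refine integral_congr_ae (Eventually.of_forall fun x => ?_)
  simp only
  rw [hWdef, divergence_norm_rpow_smul hv hdiv hθ x]
  ring

end Pressure

/-! ### The `L^θ` production along a Navier–Stokes slice -/

section Slice

/-- **The `L^θ` energy rate along a Navier–Stokes time slice** (Lemarié-Rieusset 2016, proof of
Prop. 11.7, the display after (11.46) for `θ = 4` and after (11.53) in general, with `f = 0`:
`d/dt ‖u‖_θ^θ = -νθ ∫|u|^{θ-2}|∇⊗u|² - νθ(θ-2) Σⱼ∫|∂ⱼu·u|²|u|^{θ-4} - θ ∫ |u|^{θ-2} u·∇ϖ`, and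
the pressure pairing integrated by parts). Let `v : ℝ³ → ℝ³` be `C²`, bounded and divergence
free, `q : ℝ³ → ℝ` be `C¹` and `W : ℝ³ → ℝ³` any field with the momentum equation
`W + (v·∇)v = νΔv - ∇q`, and `v, Dv, D²v, q, Dq ∈ L²`; let `θ ≥ 4`. Then
`θ ∫ ‖v‖^{θ-2} ⟪v, W⟫ = -νθ ∫ (‖v‖^{θ-2}|∇v|²_F + (θ-2)‖v‖^{θ-4} Σᵢ⟪v, ∂ᵢv⟫²)
  + θ(θ-2) ∫ q ‖v‖^{θ-4} ⟪v, (v·∇)v⟫`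
(the density `θ‖v‖^{θ-2}⟪v, ∂ₜv⟫` of `IsSmoothSpaceTimeOn.lTheta_balance`, evaluated with
`integral_inner_laplacian_norm_rpow_smul`, `integral_inner_convect_norm_rpow_smul_eq_zero` and
`integral_inner_gradient_norm_rpow_smul`). RANGE OF `θ` (referee F28.2): Lemarié-Rieusset's `L^θ`
computation (PDF pp. 365–366) is written for `θ ≥ 2` ("as `θ ≥ 2`", p. 365), and the pressure term is
expanded "for `θ ≥ 4`" as `∇|u|^{θ-2} = (2(θ-2)/θ)|u|^{θ/2-2}∇(|u|^{θ/2})` (p. 366, before (11.55));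
the hypothesis `θ ≥ 4` HERE is that of the two evaluated pairings (the test field `‖v‖^{θ-2}v` and
the weight `‖v‖^{θ-4}` are used as `C¹` resp. continuous functions, which fails near zeros of `v` for
`2 ≤ θ < 4`), and costs nothing downstream: the applications are `θ = 4` (Prop. 11.7, case
`1 < q < 3`) and `θ = 3q - 2 ≥ 7` (case `q ≥ 3`).
[cite: LemarieRieusset2016, §11.5 Prop. 11.7 proof, (11.46)–(11.47) and (11.53)–(11.54) (PDF pp. 363–366)] -/
theorem integral_norm_rpow_inner_eq_of_momentum {ν : ℝ}
    {v W : EuclideanSpace ℝ (Fin 3) → EuclideanSpace ℝ (Fin 3)} {q : EuclideanSpace ℝ (Fin 3) → ℝ}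
    (hv : ContDiff ℝ 2 v) (hq : ContDiff ℝ 1 q)
    (hmom : ∀ x, W x + FluidPDE.convect v v x = ν • (Δ v) x - gradient q x)
    (hdiv : VectorCalculus.IsDivFree v) {B : ℝ} (hB : ∀ x, ‖v x‖ ≤ B)
    {θ : ℝ} (hθ : 4 ≤ θ)
    (hv0 : ∫⁻ x, ‖v x‖ₑ ^ 2 < ⊤) (hv1 : ∫⁻ x, ‖iteratedFDeriv ℝ 1 v x‖ₑ ^ 2 < ⊤)
    (hv2 : ∫⁻ x, ‖iteratedFDeriv ℝ 2 v x‖ₑ ^ 2 < ⊤)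
    (hq0 : ∫⁻ x, ‖q x‖ₑ ^ 2 < ⊤) (hq1 : ∫⁻ x, ‖iteratedFDeriv ℝ 1 q x‖ₑ ^ 2 < ⊤) :
    ∫ x, θ * ‖v x‖ ^ (θ - 2) * ⟪v x, W x⟫ =
      -(ν * θ) * (∫ x, (‖v x‖ ^ (θ - 2) * FluidPDE.frobeniusNormSq (fderiv ℝ v x) +
          (θ - 2) * ‖v x‖ ^ (θ - 4) *
            ∑ i, ⟪v x, fderiv ℝ v x (EuclideanSpace.basisFun (Fin 3) ℝ i)⟫ ^ 2)) +
        θ * (θ - 2) * ∫ x, q x * (‖v x‖ ^ (θ - 4) * ⟪v x, FluidPDE.convect v v x⟫) := by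
  set e := EuclideanSpace.basisFun (Fin 3) ℝ with he
  have hB0 : 0 ≤ B := (norm_nonneg _).trans (hB 0)
  have hθ2 : 2 ≤ θ - 2 := by linarith
  have hv1' : ContDiff ℝ 1 v := hv.of_le (by norm_num)
  -- the three identities, with the weight pulled out of the inner products
  have hI1 := integral_inner_laplacian_norm_rpow_smul hv hθ hB hv0 hv1 hv2
  have hI2 := integral_inner_convect_norm_rpow_smul_eq_zero hv1' hdiv (by linarith : (2:ℝ) ≤ θ)
    hB hv0 hv1
  have hI3 := integral_inner_gradient_norm_rpow_smul hq hv1' hdiv hθ hB hv0 hv1 hq0 hq1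
  have hsm : ∀ (a : EuclideanSpace ℝ (Fin 3)) x, ⟪a, ‖v x‖ ^ (θ - 2) • v x⟫ =
      ‖v x‖ ^ (θ - 2) * ⟪v x, a⟫ := fun a x => by
    rw [inner_smul_right, real_inner_comm]
  simp_rw [hsm] at hI1 hI2 hI3
  -- rewrite `W` through the momentum equation
  have hWx : ∀ x, W x = ν • (Δ v) x - FluidPDE.convect v v x - gradient q x := by
    intro x
    have h : W x = ν • (Δ v) x - gradient q x - FluidPDE.convect v v x :=
      eq_sub_iff_add_eq.2 (hmom x)
    rw [h]; abel
  have hpt : ∀ x, θ * ‖v x‖ ^ (θ - 2) * ⟪v x, W x⟫ =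
      θ * (ν * (‖v x‖ ^ (θ - 2) * ⟪v x, (Δ v) x⟫) - ‖v x‖ ^ (θ - 2) * ⟪v x, FluidPDE.convect v v x⟫ -
        ‖v x‖ ^ (θ - 2) * ⟪v x, gradient q x⟫) := by
    intro x
    rw [hWx, inner_sub_right, inner_sub_right, inner_smul_right]
    ring
  -- continuity and `L²` bookkeeping
  have cv : Continuous v := hv.continuous
  have cDv : Continuous (fderiv ℝ v) := hv.continuous_fderiv (by simp)
  have cdvs : ∀ i, Continuous fun x => fderiv ℝ (fun y => fderiv ℝ v y (e i)) x (e i) := fun i =>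
    ((((hv.fderiv_right (m := 1) (by norm_num)).clm_apply contDiff_const).continuous_fderiv
      (by norm_num)).clm_apply continuous_const)
  have hΔeq : Δ v = fun y => ∑ i, fderiv ℝ (fun z => fderiv ℝ v z (e i)) y (e i) :=
    funext fun y => FluidPDE.laplacian_eq_sum_fderiv_fderiv e hv y
  have hΔc : Continuous (Δ v) := by
    rw [hΔeq]; exact continuous_finsetSum _ fun i _ => cdvs i
  have cpow : Continuous fun x => ‖v x‖ ^ (θ - 2) := (contDiff_norm_rpow hv1' hθ2).continuous
  have cBv : Continuous fun x => (B ^ (θ - 2)) • v x := cv.const_smul (B ^ (θ - 2))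
  have hpowB : ∀ y, ‖v y‖ ^ (θ - 2) ≤ B ^ (θ - 2) := fun y =>
    Real.rpow_le_rpow (norm_nonneg _) (hB y) (by linarith)
  -- `|‖v‖^{θ-2} ⟪v, a⟫| ≤ ‖a‖ ‖B^{θ-2} • v‖`
  have hwt : ∀ (a : EuclideanSpace ℝ (Fin 3)) x, ‖‖v x‖ ^ (θ - 2) * ⟪v x, a⟫‖ ≤
      ‖a‖ * ‖(B ^ (θ - 2)) • v x‖ := by
    intro a x
    rw [norm_mul, Real.norm_of_nonneg (Real.rpow_nonneg (norm_nonneg _) _), norm_smul,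
      Real.norm_of_nonneg (Real.rpow_nonneg hB0 _)]
    calc ‖v x‖ ^ (θ - 2) * ‖⟪v x, a⟫‖ ≤ B ^ (θ - 2) * (‖v x‖ * ‖a‖) :=
          mul_le_mul (hpowB x) (norm_inner_le_norm _ _) (norm_nonneg _) (Real.rpow_nonneg hB0 _)
      _ = ‖a‖ * (B ^ (θ - 2) * ‖v x‖) := by ring
  have l2Bv : ∫⁻ x, ‖(B ^ (θ - 2)) • v x‖ₑ ^ 2 < ⊤ := lTheta_lintegral_enorm_sq_smul_lt_top _ hv0
  have n_Δ : ∀ x, ‖(Δ v) x‖ ≤ ‖(3 : ℝ) • iteratedFDeriv ℝ 2 v x‖ := fun x => by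
    rw [norm_smul, Real.norm_of_nonneg (by norm_num : (0 : ℝ) ≤ 3)]
    exact norm_laplacian_le_three_mul_norm_iteratedFDeriv_two hv x
  have c3D2 : Continuous fun x => (3 : ℝ) • iteratedFDeriv ℝ 2 v x :=
    (hv.continuous_iteratedFDeriv (by norm_num)).const_smul (3 : ℝ)
  have l2Δ : ∫⁻ x, ‖(3 : ℝ) • iteratedFDeriv ℝ 2 v x‖ₑ ^ 2 < ⊤ := by
    have : ∀ x, ‖(3 : ℝ) • iteratedFDeriv ℝ 2 v x‖ₑ ^ 2 =
        ENNReal.ofReal (3 ^ 2) * ‖iteratedFDeriv ℝ 2 v x‖ₑ ^ 2 := by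
      intro x
      rw [enorm_smul, mul_pow, Real.enorm_eq_ofReal (by norm_num : (0:ℝ) ≤ 3),
        ENNReal.ofReal_pow (by norm_num : (0:ℝ) ≤ 3)]
    simp_rw [this]
    rw [lintegral_const_mul' _ _ ENNReal.ofReal_ne_top]
    exact ENNReal.mul_lt_top ENNReal.ofReal_lt_top hv2
  have cconv : Continuous (FluidPDE.convect v v) := cDv.clm_apply cv
  have cBDv : Continuous fun x => B • fderiv ℝ v x := cDv.const_smul B
  have n_conv : ∀ x, ‖FluidPDE.convect v v x‖ ≤ ‖B • fderiv ℝ v x‖ := fun x => by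
    rw [FluidPDE.convect, norm_smul, Real.norm_of_nonneg hB0, mul_comm]
    exact (fderiv ℝ v x).le_opNorm_of_le (hB x)
  have hDv_eq : ∀ x, ‖fderiv ℝ v x‖ = ‖iteratedFDeriv ℝ 1 v x‖ := fun x => by
    rw [← norm_iteratedFDeriv_fderiv, norm_iteratedFDeriv_zero]
  have l2Dv : ∫⁻ x, ‖fderiv ℝ v x‖ₑ ^ 2 < ⊤ :=
    lintegral_enorm_sq_lt_top_of_norm_le (fun x => (hDv_eq x).le) hv1
  have l2BDv : ∫⁻ x, ‖B • fderiv ℝ v x‖ₑ ^ 2 < ⊤ := by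
    have : ∀ x, ‖B • fderiv ℝ v x‖ₑ ^ 2 = ‖B‖ₑ ^ 2 * ‖fderiv ℝ v x‖ₑ ^ 2 := fun x => by
      rw [enorm_smul, mul_pow]
    simp_rw [this]
    rw [lintegral_const_mul' _ _ (by simp)]
    exact ENNReal.mul_lt_top (by simp) l2Dv
  have cgq : Continuous (gradient q) := by
    have : gradient q = fun x => (InnerProductSpace.toDual ℝ _).symm (fderiv ℝ q x) := rfl
    rw [this]
    exact (InnerProductSpace.toDual ℝ (EuclideanSpace ℝ (Fin 3))).symm.continuous.comp
      (hq.continuous_fderiv one_ne_zero)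
  have n_gq : ∀ x, ‖gradient q x‖ = ‖iteratedFDeriv ℝ 1 q x‖ := fun x => by
    rw [gradient, LinearIsometryEquiv.norm_map, ← norm_iteratedFDeriv_fderiv, norm_iteratedFDeriv_zero]
  have l2gq : ∫⁻ x, ‖gradient q x‖ₑ ^ 2 < ⊤ :=
    lintegral_enorm_sq_lt_top_of_norm_le (fun x => (n_gq x).le) hq1
  have cwt : ∀ {a : EuclideanSpace ℝ (Fin 3) → EuclideanSpace ℝ (Fin 3)}, Continuous a →
      Continuous fun x => ‖v x‖ ^ (θ - 2) * ⟪v x, a x⟫ := fun ha => cpow.mul (cv.inner ha)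
  have iΔ : Integrable (fun x => ‖v x‖ ^ (θ - 2) * ⟪v x, (Δ v) x⟫) volume :=
    integrable_of_norm_le_mul_of_lintegral_sq (cwt hΔc).aestronglyMeasurable c3D2 cBv l2Δ l2Bv
      fun x => (hwt _ x).trans (mul_le_mul_of_nonneg_right (n_Δ x) (norm_nonneg _))
  have ic : Integrable (fun x => ‖v x‖ ^ (θ - 2) * ⟪v x, FluidPDE.convect v v x⟫) volume :=
    integrable_of_norm_le_mul_of_lintegral_sq (cwt cconv).aestronglyMeasurable cBDv cBv l2BDv l2Bv
      fun x => (hwt _ x).trans (mul_le_mul_of_nonneg_right (n_conv x) (norm_nonneg _))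
  have ig : Integrable (fun x => ‖v x‖ ^ (θ - 2) * ⟪v x, gradient q x⟫) volume :=
    integrable_of_norm_le_mul_of_lintegral_sq (cwt cgq).aestronglyMeasurable cgq cBv l2gq l2Bv
      fun x => hwt _ x
  -- integrate
  have hsplit : ∫ x, θ * ‖v x‖ ^ (θ - 2) * ⟪v x, W x⟫ =
      θ * (ν * (∫ x, ‖v x‖ ^ (θ - 2) * ⟪v x, (Δ v) x⟫) -
        (∫ x, ‖v x‖ ^ (θ - 2) * ⟪v x, FluidPDE.convect v v x⟫) -
        ∫ x, ‖v x‖ ^ (θ - 2) * ⟪v x, gradient q x⟫) := by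
    have iA : Integrable (fun x => ν * (‖v x‖ ^ (θ - 2) * ⟪v x, (Δ v) x⟫)) volume :=
      iΔ.const_mul ν
    have iAB : Integrable (fun x => ν * (‖v x‖ ^ (θ - 2) * ⟪v x, (Δ v) x⟫) -
        ‖v x‖ ^ (θ - 2) * ⟪v x, FluidPDE.convect v v x⟫) volume := iA.sub ic
    rw [integral_congr_ae (Eventually.of_forall hpt), integral_const_mul,
      integral_sub iAB ig, integral_sub iA ic, integral_const_mul]
  rw [hsplit, hI1, hI2, hI3]
  ring

end Slice

end Literature.Analysis.FluidPDE

end
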